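import Literature.Analysis.SpecialFunctions.LaguerrePolynomial
import Literature.NumberTheory.LFunctions.JensenHermite
import HarnessLib

/-!
# The zeros of the generalized Laguerre polynomials: real, simple, positive, interlaced

For a real parameter `α > -1` and every degree `n`, the generalized Laguerre polynomial
`L_n^{(α)}` (`Literature.Analysis.SpecialFunctions.laguerre α n`, Szegő (5.1.6)) has `n` simple real
zeros, all of them positive, and the zeros of `L_{n+1}^{(α)}` separate those of `L_n^{(α)}`
(Szegő, *Orthogonal Polynomials*, Thm. 3.3.1–3.3.2 applied to §5.1). The classical proofs use
orthogonality with respect to `x^α e^{-x} dx`; here everything is derived from the THREE-TERM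
RECURRENCE (5.1.10) alone (`laguerre_three_term`), by the Sturm-type induction that
`JensenHermite.lean` runs for the Hermite polynomials (`Interlaces`, `Interlaces.step`):

* `Interlaces.translate`, `Interlaces.step_shift` — the interlacing invariant is translation
  invariant, hence the induction step also works for recurrences `R = (X - a)·Q - c·P`, `c > 0`
  (the general shape of the monic three-term recurrence of orthogonal polynomials, Szegő (3.2.1));
* `monicLaguerre_three_term` — the recurrence for `Q_n := (-1)^n n! · L_n^{(α)}` (monic):
  `Q_{n+2} = (X - (2n+3+α)) Q_{n+1} - (n+1)(n+1+α) Q_n`;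
* `monicLaguerre_interlaces` — `Q_{n+1}` and `Q_n` interlace for every `n` (`α > -1`);
* `laguerre_eq_C_mul_prod_roots`, `splits_laguerre`, `card_roots_laguerre`, `nodup_roots_laguerre` —
  `L_n^{(α)} = ((-1)^n/n!) ∏_{i<n} (X - rᵢ)` with `r₀ < ⋯ < r_{n-1}`: hyperbolic with simple zeros;
* `eval_laguerre_pos_of_nonpos`, `pos_of_isRoot_laguerre` — `L_n^{(α)}(x) > 0` for `x ≤ 0`
  (every coefficient of `L_n^{(α)}(-y)` is positive), so all zeros are positive (Szegő Thm. 3.3.1 /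
  §5.1: the zeros lie in the interior `(0, ∞)` of the orthogonality interval).

Used by the Jensen track as the statement that the LAGUERRE SKELETON
`(d!/(b)_{n+d}) L_d^{(n-1/2)}(-X)` of the Jensen polynomials of `ξ` (`JensenLaguerreSkeleton.lean`) is
hyperbolic with `d` simple zeros for every degree `d` and shift `n`.

## References
* [Szego1975] G. Szegő, *Orthogonal Polynomials*, AMS Colloq. Publ. 23, 4th ed. (1975), Thm. 3.3.1,
  Thm. 3.3.2, (3.2.1), §5.1 (5.1.6), (5.1.7), (5.1.10).
-/

open Polynomial Finset
open scoped Nat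

noncomputable section

namespace Literature.NumberTheory.LFunctions

/-! ### Translation invariance of the interlacing invariant; the shifted induction step -/

/-- The interlacing invariant is preserved by the translation `X ↦ X + a` (roots move by `-a`).
[cite: Szego1975, Thm. 3.3.2] -/
theorem Interlaces.translate {n : ℕ} {Q P : ℝ[X]} (h : Interlaces n Q P) (a : ℝ) :
    Interlaces n (Q.comp (X + C a)) (P.comp (X + C a)) := by
  obtain ⟨r, hr, hQ, hsign⟩ := h
  refine ⟨fun i => r i - a, fun i j hij => sub_lt_sub_right (hr hij) a, ?_, fun i => ?_⟩
  · rw [hQ, Polynomial.prod_comp]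
    refine Finset.prod_congr rfl fun i _ => ?_
    rw [sub_comp, X_comp, C_comp, C_sub]
    ring
  · have : (P.comp (X + C a)).eval (r i - a) = P.eval (r i) := by
      rw [eval_comp, eval_add, eval_X, eval_C, sub_add_cancel]
    rw [this]
    exact hsign i

/-- **Shifted interlacing step** (Szegő §3.3 for the general monic three-term recurrence
`p_{n+1} = (X - a_n) p_n - c_n p_{n-1}`, `c_n > 0`, Szegő (3.2.1)): if `(Q, P)` interlace, `deg P ≤ n`,
`c > 0`, then `((X - a)·Q - c·P, Q)` interlace. Reduced to `Interlaces.step` (the case `a = 0`) by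
translating by `a` and back. [cite: Szego1975, Thm. 3.3.2] -/
theorem Interlaces.step_shift {n : ℕ} {Q P : ℝ[X]} (h : Interlaces n Q P) (hn : 1 ≤ n)
    (hP : P.natDegree < n + 1) (a : ℝ) {c : ℝ} (hc : 0 < c) :
    Interlaces (n + 1) ((X - C a) * Q - C c * P) Q := by
  have h1 := h.translate a
  have hP1 : (P.comp (X + C a)).natDegree < n + 1 := by
    rw [natDegree_comp, show (X + C a : ℝ[X]) = X - C (-a) by simp, natDegree_X_sub_C, mul_one]
    exact hP
  have h2 := (h1.step hn hP1 hc).translate (-a)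
  have hback : ∀ S : ℝ[X], (S.comp (X + C a)).comp (X + C (-a)) = S := fun S => by
    rw [comp_assoc, add_comp, X_comp, C_comp, map_neg, add_assoc, neg_add_cancel, add_zero, comp_X]
  have e1 : (Q.comp (X + C a)).comp (X + C (-a)) = Q := hback Q
  have e2 : ((X * Q.comp (X + C a) - C c * P.comp (X + C a)).comp (X + C (-a)))
      = (X - C a) * Q - C c * P := by
    rw [sub_comp, mul_comp, mul_comp, X_comp, C_comp, hback, hback, map_neg, ← sub_eq_add_neg]
  rw [e1, e2] at h2
  exact h2

end Literature.NumberTheory.LFunctions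

namespace Literature.Analysis.SpecialFunctions

open Literature.NumberTheory.LFunctions (Interlaces Interlaces.step_shift splits_of_roots)

/-! ### The monic Laguerre polynomials `Q_n = (-1)^n n! L_n^{(α)}` and their recurrence -/

/-- `(-1)^n · (-1)^n = 1`. [folklore] -/
private theorem neg_one_pow_mul_neg_one_pow (n : ℕ) : ((-1 : ℝ)) ^ n * (-1) ^ n = 1 := by
  rw [← pow_add, ← two_mul]; exact (even_two_mul _).neg_one_pow

/-- `(-1)^n n! · L_n^{(α)}` is monic. [cite: Szego1975, (5.1.6)] -/
theorem monic_monicLaguerre (α : ℝ) (n : ℕ) :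
    (C ((-1) ^ n * (n ! : ℝ)) * laguerre α n).Monic := by
  have hn : (n ! : ℝ) ≠ 0 := by positivity
  rw [Monic, leadingCoeff_mul, leadingCoeff_C, leadingCoeff_laguerre,
    show ((-1 : ℝ)) ^ n * (n ! : ℝ) * ((-1) ^ n / (n ! : ℝ)) = ((-1 : ℝ) ^ n * (-1) ^ n) * ((n ! : ℝ) / n !)
      by ring, neg_one_pow_mul_neg_one_pow, div_self hn, one_mul]

/-- `deg ((-1)^n n! · L_n^{(α)}) = n`. [cite: Szego1975, (5.1.6)] -/
theorem natDegree_monicLaguerre (α : ℝ) (n : ℕ) :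
    (C ((-1) ^ n * (n ! : ℝ)) * laguerre α n).natDegree = n := by
  rw [natDegree_C_mul (by positivity), natDegree_laguerre]

/-- **Monic three-term recurrence** [Szegő (5.1.10) rescaled, shape (3.2.1)]:
`Q_{n+2} = (X - (2n+3+α))·Q_{n+1} - (n+1)(n+1+α)·Q_n` for `Q_n = (-1)^n n! L_n^{(α)}`.
[cite: Szego1975, (5.1.10)] -/
theorem monicLaguerre_three_term (α : ℝ) (n : ℕ) :
    C ((-1) ^ (n + 2) * ((n + 2)! : ℝ)) * laguerre α (n + 2)
      = (X - C (2 * n + 3 + α)) * (C ((-1) ^ (n + 1) * ((n + 1)! : ℝ)) * laguerre α (n + 1))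
        - C (((n : ℝ) + 1) * ((n : ℝ) + 1 + α)) * (C ((-1) ^ n * (n ! : ℝ)) * laguerre α n) := by
  have h := laguerre_three_term α n
  have hf2 : ((n + 2)! : ℝ) = ((n : ℝ) + 2) * ((n : ℝ) + 1) * (n ! : ℝ) := by
    rw [Nat.factorial_succ, Nat.factorial_succ]; push_cast; ring
  have hf1 : ((n + 1)! : ℝ) = ((n : ℝ) + 1) * (n ! : ℝ) := by
    rw [Nat.factorial_succ]; push_cast; ring
  have hp2 : ((-1 : ℝ)) ^ (n + 2) = (-1) ^ n := by rw [pow_add]; norm_num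
  have hp1 : ((-1 : ℝ)) ^ (n + 1) = -(-1) ^ n := by rw [pow_succ]; ring
  rw [hf2, hf1, hp2, hp1]
  -- multiply Szegő's recurrence by `(-1)^n (n+1) n!`, all scalars pushed through `C`
  simp only [map_mul, map_neg, map_add, map_natCast, map_ofNat, map_pow, map_one] at h ⊢
  linear_combination ((-1 : ℝ[X]) ^ n * ((n : ℝ[X]) + 1) * (n ! : ℝ[X])) * h

/-! ### Interlacing by induction on the degree -/

/-- **`Q_{n+1}` and `Q_n` interlace for every `n`** (`α > -1`): induction on the monic recurrence with
`c_n = (n+1)(n+1+α) > 0`, base `Q₁ = X - (α+1)`, `Q₀ = 1`. [cite: Szego1975, Thm. 3.3.2] -/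
theorem monicLaguerre_interlaces {α : ℝ} (hα : -1 < α) :
    ∀ n : ℕ, Interlaces (n + 1) (C ((-1) ^ (n + 1) * ((n + 1)! : ℝ)) * laguerre α (n + 1))
      (C ((-1) ^ n * (n ! : ℝ)) * laguerre α n)
  | 0 => by
    refine ⟨fun _ => α + 1, fun i j hij => absurd hij (by simp [Fin.lt_def]), ?_, ?_⟩
    · show C ((-1) ^ 1 * ((1 : ℕ)! : ℝ)) * laguerre α 1 = ∏ _i : Fin 1, (X - C (α + 1))
      rw [Fin.prod_univ_one, laguerre_one, pow_one, Nat.factorial_one, Nat.cast_one, mul_one, C_add,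
        C_1, C_neg, C_1]
      ring
    · intro i
      have : i = 0 := Fin.ext (by omega)
      subst this
      simp [laguerre_zero]
  | n + 1 => by
    have hc : 0 < ((n : ℝ) + 1) * ((n : ℝ) + 1 + α) := by
      have : (0 : ℝ) < (n : ℝ) + 1 + α := by have := (Nat.cast_nonneg n : (0:ℝ) ≤ n); linarith
      positivity
    have h := (monicLaguerre_interlaces hα n).step_shift (by omega)
      (by rw [natDegree_monicLaguerre]; omega) (2 * n + 3 + α) hc
    rwa [← monicLaguerre_three_term] at h

/-! ### Real simple zeros, hyperbolicity -/

/-- **The zeros of `L_n^{(α)}` are real and simple** (`α > -1`):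
`L_n^{(α)} = ((-1)^n / n!) · ∏_{i<n} (X - rᵢ)` with `r₀ < r₁ < ⋯ < r_{n-1}`. [cite: Szego1975, Thm. 3.3.1] -/
theorem laguerre_eq_C_mul_prod_roots {α : ℝ} (hα : -1 < α) (n : ℕ) :
    ∃ r : Fin n → ℝ, StrictMono r ∧
      laguerre α n = C ((-1) ^ n / (n ! : ℝ)) * ∏ i, (X - C (r i)) := by
  have hQ : ∃ r : Fin n → ℝ, StrictMono r ∧
      C ((-1) ^ n * (n ! : ℝ)) * laguerre α n = ∏ i, (X - C (r i)) := by
    rcases n with _ | n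
    · exact ⟨fun i => i.elim0, fun i => i.elim0, by simp [laguerre_zero]⟩
    · obtain ⟨r, hr, h, -⟩ := monicLaguerre_interlaces hα n
      exact ⟨r, hr, h⟩
  obtain ⟨r, hr, h⟩ := hQ
  refine ⟨r, hr, ?_⟩
  rw [← h, ← mul_assoc, ← C_mul]
  have hn : (n ! : ℝ) ≠ 0 := by positivity
  have : ((-1 : ℝ)) ^ n / (n ! : ℝ) * ((-1) ^ n * (n ! : ℝ)) = 1 := by
    rw [show ((-1 : ℝ)) ^ n / (n ! : ℝ) * ((-1) ^ n * (n ! : ℝ)) = ((-1 : ℝ) ^ n * (-1) ^ n) * ((n ! : ℝ) / n !)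
      by ring, neg_one_pow_mul_neg_one_pow, div_self hn, one_mul]
  rw [this, C_1, one_mul]

/-- **`L_n^{(α)}` is hyperbolic** (splits over `ℝ`) for `α > -1`. [cite: Szego1975, Thm. 3.3.1] -/
theorem splits_laguerre {α : ℝ} (hα : -1 < α) (n : ℕ) : (laguerre α n).Splits := by
  obtain ⟨r, -, h⟩ := laguerre_eq_C_mul_prod_roots hα n
  rw [h]
  exact (Splits.C _).mul (Splits.prod fun i _ => Splits.X_sub_C _)

/-- The roots of `L_n^{(α)}` (`α > -1`), as a multiset, are `{r₀, …, r_{n-1}}` for a strictly increasing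
enumeration `r`; in particular there are exactly `n` of them and they are pairwise distinct.
[cite: Szego1975, Thm. 3.3.1] -/
theorem roots_laguerre_eq {α : ℝ} (hα : -1 < α) (n : ℕ) :
    ∃ r : Fin n → ℝ, StrictMono r ∧ (laguerre α n).roots = Finset.univ.val.map r := by
  obtain ⟨r, hr, h⟩ := laguerre_eq_C_mul_prod_roots hα n
  refine ⟨r, hr, ?_⟩
  have hroot : ∀ i, (laguerre α n).eval (r i) = 0 := fun i => by
    rw [h, eval_mul, eval_prod]
    exact mul_eq_zero_of_right _ (Finset.prod_eq_zero (Finset.mem_univ i) (by simp))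
  exact (splits_of_roots (laguerre_ne_zero α n) (natDegree_laguerre α n).le r hr.injective hroot).2.2

/-- `L_n^{(α)}` has exactly `n` real roots counted with multiplicity (`α > -1`). [cite: Szego1975, Thm. 3.3.1] -/
theorem card_roots_laguerre {α : ℝ} (hα : -1 < α) (n : ℕ) : (laguerre α n).roots.card = n := by
  obtain ⟨r, -, h⟩ := roots_laguerre_eq hα n
  simp [h]

/-- The roots of `L_n^{(α)}` are simple (`α > -1`). [cite: Szego1975, Thm. 3.3.1] -/
theorem nodup_roots_laguerre {α : ℝ} (hα : -1 < α) (n : ℕ) : (laguerre α n).roots.Nodup := by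
  obtain ⟨r, hr, h⟩ := roots_laguerre_eq hα n
  rw [h]
  exact Multiset.Nodup.map hr.injective Finset.univ.nodup

/-! ### Positivity of the zeros -/

/-- For `α > -1` and `x ≤ 0`: `L_n^{(α)}(x) > 0` — every term `binom(n+α, n-k)(-x)^k/k!` of Szegő
(5.1.6) is `≥ 0` and the constant term `(α+1)_n/n!` is `> 0`. [cite: Szego1975, (5.1.7)] -/
theorem eval_laguerre_pos_of_nonpos {α : ℝ} (hα : -1 < α) (n : ℕ) {x : ℝ} (hx : x ≤ 0) :
    0 < (laguerre α n).eval x := by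
  rw [eval_laguerre]
  have hterm : ∀ k ∈ range (n + 1), 0 ≤ laguerreCoeff α n k * x ^ k := by
    intro k hk
    rw [laguerreCoeff]
    have h1 : 0 < (ascPochhammer ℝ (n - k)).eval (α + k + 1) :=
      ascPochhammer_eval_pos (by have := (Nat.cast_nonneg k : (0:ℝ) ≤ k); linarith) _
    have h2 : 0 ≤ (-1 : ℝ) ^ k * x ^ k := by
      rw [← mul_pow]; exact pow_nonneg (by linarith) k
    have h3 : (0 : ℝ) < ((n - k)! : ℝ) * (k ! : ℝ) := by positivity
    have : (-1 : ℝ) ^ k * (ascPochhammer ℝ (n - k)).eval (α + k + 1) / (((n - k)! : ℝ) * (k ! : ℝ)) * x ^ k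
        = ((ascPochhammer ℝ (n - k)).eval (α + k + 1) / (((n - k)! : ℝ) * (k ! : ℝ))) * ((-1) ^ k * x ^ k) := by
      ring
    rw [this]
    exact mul_nonneg (div_nonneg h1.le h3.le) h2
  have h0 : 0 < laguerreCoeff α n 0 * x ^ 0 := by
    rw [pow_zero, mul_one, laguerreCoeff, pow_zero, one_mul, Nat.sub_zero, Nat.factorial_zero,
      Nat.cast_one, mul_one, Nat.cast_zero, add_zero]
    exact div_pos (ascPochhammer_eval_pos (by linarith) _) (by positivity)
  exact Finset.sum_pos' hterm ⟨0, by simp, h0⟩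

/-- **The zeros of `L_n^{(α)}` are positive** (`α > -1`). [cite: Szego1975, Thm. 3.3.1] -/
theorem pos_of_isRoot_laguerre {α : ℝ} (hα : -1 < α) {n : ℕ} {x : ℝ} (hx : (laguerre α n).IsRoot x) :
    0 < x := by
  by_contra h
  exact (eval_laguerre_pos_of_nonpos hα n (not_lt.mp h)).ne' hx

/-- All members of the root multiset of `L_n^{(α)}` are positive (`α > -1`). [cite: Szego1975, Thm. 3.3.1] -/
theorem pos_of_mem_roots_laguerre {α : ℝ} (hα : -1 < α) {n : ℕ} {x : ℝ}
    (hx : x ∈ (laguerre α n).roots) : 0 < x :=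
  pos_of_isRoot_laguerre hα ((mem_roots (laguerre_ne_zero α n)).mp hx)

/-- **Summary (Szegő Thm. 3.3.1 for Laguerre)**: for `α > -1`, `L_n^{(α)} = ((-1)^n/n!) ∏_{i<n}(X - rᵢ)`
with `0 < r₀ < r₁ < ⋯ < r_{n-1}`. [cite: Szego1975, Thm. 3.3.1] -/
theorem laguerre_eq_C_mul_prod_pos_roots {α : ℝ} (hα : -1 < α) (n : ℕ) :
    ∃ r : Fin n → ℝ, StrictMono r ∧ (∀ i, 0 < r i) ∧
      laguerre α n = C ((-1) ^ n / (n ! : ℝ)) * ∏ i, (X - C (r i)) := by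
  obtain ⟨r, hr, h⟩ := laguerre_eq_C_mul_prod_roots hα n
  refine ⟨r, hr, fun i => pos_of_isRoot_laguerre hα (n := n) ?_, h⟩
  rw [IsRoot, h, eval_mul, eval_prod]
  exact mul_eq_zero_of_right _ (Finset.prod_eq_zero (Finset.mem_univ i) (by simp))

/-- **Interlacing (Szegő Thm. 3.3.2 for Laguerre)**: for `α > -1`, writing
`L_{n+1}^{(α)} = ((-1)^{n+1}/(n+1)!) ∏_{j ≤ n} (X - t_j)` with `t₀ < ⋯ < t_n`, the values of
`L_n^{(α)}` at the `t_j` alternate strictly in sign, `(-1)^j L_n^{(α)}(t_j) > 0`; hence each gap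
`(t_j, t_{j+1})` contains a zero of `L_n^{(α)}`, and consecutive Laguerre polynomials have no common
zero. [cite: Szego1975, Thm. 3.3.2] -/
theorem laguerre_succ_interlaces {α : ℝ} (hα : -1 < α) (n : ℕ) :
    ∃ t : Fin (n + 1) → ℝ, StrictMono t ∧
      laguerre α (n + 1) = C ((-1) ^ (n + 1) / ((n + 1)! : ℝ)) * ∏ j, (X - C (t j)) ∧
      ∀ j : Fin (n + 1), 0 < (-1) ^ (j : ℕ) * (laguerre α n).eval (t j) := by
  obtain ⟨t, ht, hQ, hsign⟩ := monicLaguerre_interlaces hα n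
  refine ⟨t, ht, ?_, fun j => ?_⟩
  · rw [← hQ, ← mul_assoc, ← C_mul]
    have hn : ((n + 1)! : ℝ) ≠ 0 := by positivity
    have : ((-1 : ℝ)) ^ (n + 1) / ((n + 1)! : ℝ) * ((-1) ^ (n + 1) * ((n + 1)! : ℝ)) = 1 := by
      rw [show ((-1 : ℝ)) ^ (n + 1) / ((n + 1)! : ℝ) * ((-1) ^ (n + 1) * ((n + 1)! : ℝ))
          = ((-1 : ℝ) ^ (n + 1) * (-1) ^ (n + 1)) * (((n + 1)! : ℝ) / (n + 1)!) by ring,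
        neg_one_pow_mul_neg_one_pow, div_self hn, one_mul]
    rw [this, C_1, one_mul]
  · have h := hsign j
    rw [eval_mul, eval_C] at h
    have hn : (0 : ℝ) < n ! := by positivity
    -- `(-1)^{n+1+1+j} · (-1)^n = (-1)^j · ((-1)^{n+1})²`
    have e : ((-1 : ℝ)) ^ (n + 1 + 1 + (j : ℕ)) * ((-1) ^ n * (n ! : ℝ) * (laguerre α n).eval (t j))
        = (n ! : ℝ) * ((-1) ^ (j : ℕ) * (laguerre α n).eval (t j))
          * ((-1 : ℝ) ^ (n + 1) * (-1) ^ (n + 1)) := by ring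
    rw [e, neg_one_pow_mul_neg_one_pow, mul_one] at h
    exact lt_of_mul_lt_mul_left (a := (n ! : ℝ)) (by rwa [mul_zero]) hn.le

/-- Consecutive Laguerre polynomials have no common zero (`α > -1`). [cite: Szego1975, Thm. 3.3.2] -/
theorem laguerre_eval_ne_zero_of_succ_eval_eq_zero {α : ℝ} (hα : -1 < α) (n : ℕ) {x : ℝ}
    (hx : (laguerre α (n + 1)).eval x = 0) : (laguerre α n).eval x ≠ 0 := by
  obtain ⟨t, ht, hQ, hsign⟩ := laguerre_succ_interlaces hα n
  have hx' : x ∈ (laguerre α (n + 1)).roots := (mem_roots (laguerre_ne_zero α _)).mpr hx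
  rw [hQ, roots_C_mul _ (by
    have : ((n + 1)! : ℝ) ≠ 0 := by positivity
    exact div_ne_zero (pow_ne_zero _ (by norm_num)) this), roots_prod _ _ (by
    rw [Finset.prod_ne_zero_iff]; exact fun j _ => X_sub_C_ne_zero _)] at hx'
  simp only [roots_X_sub_C, Multiset.mem_bind, Finset.mem_val, Finset.mem_univ, true_and,
    Multiset.mem_singleton] at hx'
  obtain ⟨j, rfl⟩ := hx'
  intro h0
  have := hsign j
  rw [h0, mul_zero] at this
  exact lt_irrefl 0 this

end Literature.Analysis.SpecialFunctions

end
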